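import Mathlib.Combinatorics.SetFamily.LYM
import Mathlib.Tactic.Ring
import Mathlib.Tactic.Linarith
import HarnessLib

/-!
# `NoHeavyLowerTail` (crux stmt-CriticalPhenomena-4575), lane prim-ineq-gen-4 (gen 16): SIZE DOMINANCE in disjoint
# (up-set member, down-set member) pairs — the counting engine behind the proved faces of the threshold recursion

Support file (`--supports stmt-CriticalPhenomena-4575`; memo `run/shared/lean/prim/prim-ineq-gen-4/FINDING-THRESHOLD-TREC-g16.md`,
proofs `PROOFS-TREC-FACES-g16.md`, Lemma A).  Pure finite combinatorics, no definitions, standard axioms.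

MAIN THEOREM (`card_filter_le_card_filter_of_isUpperSet_of_isLowerSet`, "size dominance"): let `X` be an up-set and `Y` a
down-set of finite sets (of a finite type).  Among the ordered pairs `(y, z)` with `y ∈ X`, `z ∈ Y`, `y ∩ z = ∅`, for every
threshold `i` there are at least as many pairs with `i ≤ #y` as pairs with `i ≤ #z`: the size of the up-set member
stochastically dominates the size of the down-set member.  Special cases: `Y = univ` ("graded Kleitman": in disjoint pairs
(member of `X`, anything) the member is stochastically larger) and `Y = Xᶜ` (in disjoint (member, non-member) pairs of an up-set
the member is stochastically larger).  These are exactly the inequalities that prove the faces `{V¹ = W¹ = ⊤}` and `{W = ⊤}` of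
the lane's threshold recursion `c₁ ≥ c₀ + c₃` for three-partition positivity with a threshold slot (memo §1b).

PROOF (formalised below): group the pairs by `W = y ∪ z`; the fibre over `W` is `{y ⊆ W | y ∈ X, W \ y ∈ Y}`, an up-set inside
`𝒫(W)`; for such a family the level sizes satisfy the local LYM inequality `#F_s · (#W − s) ≤ #F_{s+1} · (s+1)` (double
counting `y ⊆ y'`), hence `#F_s · C(#W,t) ≤ #F_t · C(#W,s)` for `s ≤ t ≤ #W` and `#F_s ≤ #F_{#W−s}` for `2s ≤ #W`; comparing the
level sums `Σ_{s ≤ #W − i} #F_s` and `Σ_{s ≥ i} #F_s` levelwise gives the fibre inequality, and summing over `W` the theorem.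
-/

namespace Summit.CriticalPhenomena.PercolationContinuityZ3.Theorems.SizeDominance

open Finset

variable {α : Type*} [DecidableEq α]

/-- **Local LYM inside `𝒫(W)` for an up-closed family** (double counting the pairs `y ⊆ y'` between consecutive levels):
`#F_s · (#W − s) ≤ #F_{s+1} · (s + 1)`. [folklore] -/
theorem card_level_mul_le (W : Finset α) (F : Finset (Finset α))
    (hup : ∀ y ∈ F, ∀ a ∈ W, insert a y ∈ F) (s : ℕ) :
    #(F.filter fun y => #y = s) * (#W - s) ≤ #(F.filter fun y => #y = s + 1) * (s + 1) := by
  refine card_mul_le_card_mul (fun y y' => y ⊆ y') (fun y hy => ?_) (fun y' hy' => ?_)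
  · -- the `#W - s` sets `insert a y`, `a ∈ W \ y`, lie above `y`
    rw [mem_filter] at hy
    obtain ⟨hyF, hys⟩ := hy
    have hsub : (W \ y).image (fun a => insert a y) ⊆
        (F.filter fun y => #y = s + 1).bipartiteAbove (fun y y' => y ⊆ y') y := by
      intro y' hy'
      rw [mem_image] at hy'
      obtain ⟨a, ha, rfl⟩ := hy'
      rw [mem_sdiff] at ha
      rw [mem_bipartiteAbove, mem_filter]
      exact ⟨⟨hup y hyF a ha.1, by rw [card_insert_of_notMem ha.2, hys]⟩, subset_insert a y⟩
    have hinj : Set.InjOn (fun a => insert a y) ↑(W \ y) := by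
      intro a ha b hb hab
      rw [mem_coe, mem_sdiff] at ha hb
      have hab' : insert a y = insert b y := hab
      have : a ∈ insert b y := hab' ▸ mem_insert_self a y
      rcases mem_insert.1 this with h | h
      · exact h
      · exact absurd h ha.2
    calc #W - s = #W - #y := by rw [hys]
      _ ≤ #(W \ y) := le_card_sdiff y W
      _ = #((W \ y).image fun a => insert a y) := (card_image_of_injOn hinj).symm
      _ ≤ _ := card_le_card hsub
  · -- at most `s + 1` members of level `s` lie below `y'`: they are among the `erase`s of `y'`
    rw [mem_filter] at hy'
    obtain ⟨-, hys'⟩ := hy'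
    have hsub : (F.filter fun y => #y = s).bipartiteBelow (fun y y' => y ⊆ y') y' ⊆ y'.powersetCard s := by
      intro y hy
      rw [mem_bipartiteBelow, mem_filter] at hy
      rw [mem_powersetCard]
      exact ⟨hy.2, hy.1.2⟩
    calc #((F.filter fun y => #y = s).bipartiteBelow (fun y y' => y ⊆ y') y')
        ≤ #(y'.powersetCard s) := card_le_card hsub
      _ = (#y').choose s := card_powersetCard s y'
      _ = s + 1 := by rw [hys', Nat.choose_succ_self_right]

/-- Iterated local LYM inside `𝒫(W)`: the level densities of an up-closed family are non-decreasing,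
`#F_s · C(#W, t) ≤ #F_t · C(#W, s)` for `s ≤ t ≤ #W`. [folklore] -/
theorem card_level_mul_choose_le (W : Finset α) (F : Finset (Finset α))
    (hup : ∀ y ∈ F, ∀ a ∈ W, insert a y ∈ F) {s t : ℕ} (hst : s ≤ t) (htw : t ≤ #W) :
    #(F.filter fun y => #y = s) * (#W).choose t ≤ #(F.filter fun y => #y = t) * (#W).choose s := by
  induction t, hst using Nat.le_induction with
  | base => exact le_rfl
  | succ t hst ih =>
    have htw' : t ≤ #W := Nat.le_of_succ_le htw
    have ih' := ih htw'
    have hstep := card_level_mul_le W F hup t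
    have hchoose : (#W).choose (t + 1) * (t + 1) = (#W).choose t * (#W - t) := Nat.choose_succ_right_eq (#W) t
    have key : #(F.filter fun y => #y = s) * (#W).choose (t + 1) * (t + 1)
        ≤ #(F.filter fun y => #y = t + 1) * (#W).choose s * (t + 1) := by
      calc #(F.filter fun y => #y = s) * (#W).choose (t + 1) * (t + 1)
          = #(F.filter fun y => #y = s) * (#W).choose t * (#W - t) := by rw [mul_assoc, hchoose, ← mul_assoc]
        _ ≤ #(F.filter fun y => #y = t) * (#W).choose s * (#W - t) := Nat.mul_le_mul_right _ ih'
        _ = #(F.filter fun y => #y = t) * (#W - t) * (#W).choose s := by ring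
        _ ≤ #(F.filter fun y => #y = t + 1) * (t + 1) * (#W).choose s := Nat.mul_le_mul_right _ hstep
        _ = #(F.filter fun y => #y = t + 1) * (#W).choose s * (t + 1) := by ring
    exact Nat.le_of_mul_le_mul_right key (Nat.succ_pos t)

/-- Consequence: in an up-closed family inside `𝒫(W)` the low level `s` is no larger than the mirror level `#W − s`
(`2s ≤ #W`). [folklore] -/
theorem card_level_le_card_mirror (W : Finset α) (F : Finset (Finset α))
    (hup : ∀ y ∈ F, ∀ a ∈ W, insert a y ∈ F) {s : ℕ} (hs : s + s ≤ #W) :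
    #(F.filter fun y => #y = s) ≤ #(F.filter fun y => #y = #W - s) := by
  have hst : s ≤ #W - s := by omega
  have htw : #W - s ≤ #W := Nat.sub_le _ _
  have h := card_level_mul_choose_le W F hup hst htw
  rw [Nat.choose_symm (by omega : s ≤ #W)] at h
  exact Nat.le_of_mul_le_mul_right h (Nat.choose_pos (by omega))

omit [DecidableEq α] in
/-- Counting a family by levels: `#{y ∈ F | #y ∈ Q} = Σ_{s ∈ Q} #F_s`. [folklore] -/
theorem card_filter_card_mem_eq_sum (F : Finset (Finset α)) (Q : Finset ℕ) :
    #(F.filter fun y => #y ∈ Q) = ∑ s ∈ Q, #(F.filter fun y => #y = s) := by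
  have H : ((F.filter fun y => #y ∈ Q : Finset (Finset α)) : Set (Finset α)).MapsTo (fun y : Finset α => #y) Q :=
    fun y hy => (mem_filter.1 (mem_coe.1 hy)).2
  rw [card_eq_sum_card_fiberwise H]
  refine sum_congr rfl fun b hb => ?_
  congr 1
  ext y
  simp only [mem_filter]
  constructor
  · rintro ⟨⟨hyF, -⟩, hyb⟩; exact ⟨hyF, hyb⟩
  · rintro ⟨hyF, hyb⟩; exact ⟨⟨hyF, hyb ▸ hb⟩, hyb⟩

/-- **Fibre inequality.**  For an up-closed family `F` inside `𝒫(W)` and a threshold `i`: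
`#{y ∈ F | #y + i ≤ #W} ≤ #{y ∈ F | i ≤ #y}` — levels `s < i` on the left are dominated by their mirror levels `#W − s`
on the right. [this work] -/
theorem card_filter_add_le_le_card_filter_le (W : Finset α) (F : Finset (Finset α)) (hF : ∀ y ∈ F, y ⊆ W)
    (hup : ∀ y ∈ F, ∀ a ∈ W, insert a y ∈ F) (i : ℕ) :
    #(F.filter fun y => #y + i ≤ #W) ≤ #(F.filter fun y => i ≤ #y) := by
  set w := #W with hw
  -- index sets of levels
  set L1 : Finset ℕ := (range (w + 1)).filter fun s => s + i ≤ w ∧ s < i with hL1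
  set L2 : Finset ℕ := (range (w + 1)).filter fun s => s + i ≤ w ∧ i ≤ s with hL2
  set Rs : Finset ℕ := (range (w + 1)).filter fun s => i ≤ s with hRs
  have hcard : ∀ y ∈ F, #y ≤ w := fun y hy => card_le_card (hF y hy)
  -- left side as a sum over L1 ∪ L2
  have hleft : #(F.filter fun y => #y + i ≤ w) = #(F.filter fun y => #y ∈ L1 ∪ L2) := by
    congr 1; ext y
    simp only [mem_filter, mem_union, hL1, hL2, mem_range]
    constructor
    · rintro ⟨hyF, h⟩
      refine ⟨hyF, ?_⟩
      by_cases hi : #y < i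
      · exact Or.inl ⟨Nat.lt_succ_of_le (hcard y hyF), h, hi⟩
      · exact Or.inr ⟨Nat.lt_succ_of_le (hcard y hyF), h, Nat.le_of_not_lt hi⟩
    · rintro ⟨hyF, h | h⟩
      · exact ⟨hyF, h.2.1⟩
      · exact ⟨hyF, h.2.1⟩
  have hright : #(F.filter fun y => i ≤ #y) = #(F.filter fun y => #y ∈ Rs) := by
    congr 1; ext y
    simp only [mem_filter, hRs, mem_range]
    constructor
    · rintro ⟨hyF, h⟩; exact ⟨hyF, Nat.lt_succ_of_le (hcard y hyF), h⟩
    · rintro ⟨hyF, -, h⟩; exact ⟨hyF, h⟩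
  rw [hleft, hright, card_filter_card_mem_eq_sum, card_filter_card_mem_eq_sum]
  have hdisj12 : Disjoint L1 L2 := by
    rw [disjoint_left]; intro s hs1 hs2
    rw [hL1, mem_filter] at hs1; rw [hL2, mem_filter] at hs2
    omega
  rw [sum_union hdisj12]
  -- mirror the low levels
  have hmirror : ∑ s ∈ L1, #(F.filter fun y => #y = s) ≤ ∑ s ∈ L1, #(F.filter fun y => #y = w - s) := by
    refine sum_le_sum fun s hs => ?_
    rw [hL1, mem_filter] at hs
    exact card_level_le_card_mirror W F hup (by omega)
  have hinj : Set.InjOn (fun s => w - s) ↑L1 := by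
    intro s hs s' hs' h
    rw [mem_coe, hL1, mem_filter, mem_range] at hs hs'
    simp only at h
    omega
  have himage : ∑ s ∈ L1, #(F.filter fun y => #y = w - s) = ∑ t ∈ L1.image (fun s => w - s), #(F.filter fun y => #y = t) := by
    rw [sum_image hinj]
  have hdisj : Disjoint (L1.image fun s => w - s) L2 := by
    rw [disjoint_left]; intro t ht ht2
    rw [mem_image] at ht; obtain ⟨s, hs, rfl⟩ := ht
    rw [hL1, mem_filter, mem_range] at hs; rw [hL2, mem_filter, mem_range] at ht2
    omega
  have hsub : L1.image (fun s => w - s) ∪ L2 ⊆ Rs := by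
    intro t ht
    rw [mem_union] at ht
    rw [hRs, mem_filter, mem_range]
    rcases ht with ht | ht
    · rw [mem_image] at ht; obtain ⟨s, hs, rfl⟩ := ht
      rw [hL1, mem_filter, mem_range] at hs
      omega
    · rw [hL2, mem_filter, mem_range] at ht
      omega
  calc ∑ s ∈ L1, #(F.filter fun y => #y = s) + ∑ s ∈ L2, #(F.filter fun y => #y = s)
      ≤ ∑ t ∈ L1.image (fun s => w - s), #(F.filter fun y => #y = t) + ∑ s ∈ L2, #(F.filter fun y => #y = s) := by
        rw [← himage]; exact Nat.add_le_add_right hmirror _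
    _ = ∑ t ∈ L1.image (fun s => w - s) ∪ L2, #(F.filter fun y => #y = t) := (sum_union hdisj).symm
    _ ≤ ∑ t ∈ Rs, #(F.filter fun y => #y = t) := sum_le_sum_of_subset_of_nonneg hsub fun _ _ _ => Nat.zero_le _

/-- The fibre of the disjoint-pair family over `W = y ∪ z`, read through `p ↦ p.1`: pairs `(y,z)` with `y ∈ X`, `z ∈ Y`,
`y ∩ z = ∅`, `y ∪ z = W` and a condition on `(#y, #z)` correspond to members `y ⊆ W` with `y ∈ X`, `W \ y ∈ Y` and the
condition on `(#y, #W − #y)`. [folklore] -/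
theorem card_pairs_fibre_eq (X Y : Finset (Finset α)) (W : Finset α) (Q : ℕ → ℕ → Prop) [DecidableRel Q] :
    #((X ×ˢ Y).filter fun p => Disjoint p.1 p.2 ∧ p.1 ∪ p.2 = W ∧ Q #p.1 #p.2) =
      #((W.powerset.filter fun y => y ∈ X ∧ W \ y ∈ Y).filter fun y => Q #y (#W - #y)) := by
  refine card_bij' (fun p _ => p.1) (fun y _ => (y, W \ y)) (fun p hp => ?_) (fun y hy => ?_)
    (fun p hp => ?_) (fun y hy => ?_)
  · rw [mem_filter, mem_product] at hp
    obtain ⟨⟨hX, hY⟩, hd, hW, hQ⟩ := hp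
    have hz : W \ p.1 = p.2 := by rw [← hW, union_sdiff_left, sdiff_eq_self_of_disjoint hd.symm]
    rw [mem_filter, mem_filter, mem_powerset]
    refine ⟨⟨hW ▸ subset_union_left, hX, hz ▸ hY⟩, ?_⟩
    have hc : #W - #p.1 = #p.2 := by rw [← hW, card_union_of_disjoint hd]; omega
    rw [hc]; exact hQ
  · rw [mem_filter, mem_filter, mem_powerset] at hy
    obtain ⟨⟨hyW, hX, hY⟩, hQ⟩ := hy
    rw [mem_filter, mem_product]
    refine ⟨⟨hX, hY⟩, disjoint_sdiff, union_sdiff_of_subset hyW, ?_⟩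
    rw [card_sdiff_of_subset hyW]; exact hQ
  · rw [mem_filter, mem_product] at hp
    obtain ⟨-, hd, hW, -⟩ := hp
    have hz : W \ p.1 = p.2 := by rw [← hW, union_sdiff_left, sdiff_eq_self_of_disjoint hd.symm]
    exact Prod.ext rfl hz
  · rfl

/-- **SIZE DOMINANCE** (Lemma A of the lane's memo).  `X` up-closed (`insert a y ∈ X` for `y ∈ X`), `Y` down-closed
(`z.erase a ∈ Y` for `z ∈ Y`).  Among the ordered pairs `(y,z) ∈ X × Y` with `y ∩ z = ∅`, for every `i` the pairs with
`i ≤ #z` are no more numerous than the pairs with `i ≤ #y`: the size of the up-set member stochastically dominates the size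
of the down-set member. [this work] -/
theorem card_filter_snd_le_card_filter_fst (X Y : Finset (Finset α)) (hX : ∀ y ∈ X, ∀ a, insert a y ∈ X)
    (hY : ∀ z ∈ Y, ∀ a, z.erase a ∈ Y) (i : ℕ) :
    #((X ×ˢ Y).filter fun p => Disjoint p.1 p.2 ∧ i ≤ #p.2) ≤
      #((X ×ˢ Y).filter fun p => Disjoint p.1 p.2 ∧ i ≤ #p.1) := by
  -- group both sides by `W = y ∪ z`
  set T : Finset (Finset α) := (X ×ˢ Y).image fun p => p.1 ∪ p.2 with hT
  have hmaps : ∀ (Q : ℕ → ℕ → Prop) [DecidableRel Q],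
      (((X ×ˢ Y).filter fun p => Disjoint p.1 p.2 ∧ Q #p.1 #p.2 : Finset (Finset α × Finset α)) :
        Set (Finset α × Finset α)).MapsTo (fun p => p.1 ∪ p.2) T := by
    intro Q _ p hp
    rw [mem_coe, mem_filter] at hp
    exact mem_image_of_mem _ hp.1
  have hsplit : ∀ (Q : ℕ → ℕ → Prop) [DecidableRel Q],
      #((X ×ˢ Y).filter fun p => Disjoint p.1 p.2 ∧ Q #p.1 #p.2) =
        ∑ W ∈ T, #((W.powerset.filter fun y => y ∈ X ∧ W \ y ∈ Y).filter fun y => Q #y (#W - #y)) := by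
    intro Q _
    rw [card_eq_sum_card_fiberwise (hmaps Q)]
    refine sum_congr rfl fun W _ => ?_
    rw [← card_pairs_fibre_eq X Y W Q]
    congr 1; ext p
    simp only [mem_filter]
    tauto
  rw [hsplit (fun a b => i ≤ b), hsplit (fun a b => i ≤ a)]
  refine sum_le_sum fun W _ => ?_
  -- the fibre over `W` is an up-closed family inside `𝒫(W)`
  set F : Finset (Finset α) := W.powerset.filter fun y => y ∈ X ∧ W \ y ∈ Y with hF
  have hFW : ∀ y ∈ F, y ⊆ W := fun y hy => mem_powerset.1 (mem_filter.1 hy).1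
  have hup : ∀ y ∈ F, ∀ a ∈ W, insert a y ∈ F := by
    intro y hy a ha
    rw [hF, mem_filter, mem_powerset] at hy ⊢
    obtain ⟨hyW, hyX, hyY⟩ := hy
    refine ⟨insert_subset ha hyW, hX y hyX a, ?_⟩
    rw [sdiff_insert]
    exact hY _ hyY a
  have hle : #(F.filter fun y => i ≤ #W - #y) = #(F.filter fun y => #y + i ≤ #W) := by
    congr 1
    refine filter_congr fun y hy => ?_
    have := card_le_card (hFW y hy)
    omega
  rw [hle]
  exact card_filter_add_le_le_card_filter_le W F hFW hup i

/-- **Size dominance with a spectator condition**: the same with the pairs restricted by an arbitrary condition `R` on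
`y ∪ z` (equivalently on the third part `(y ∪ z)ᶜ`); the proof is fibrewise in `W = y ∪ z`, so `R` only selects fibres.
[this work] -/
theorem card_filter_snd_le_card_filter_fst_of_union (X Y : Finset (Finset α)) (hX : ∀ y ∈ X, ∀ a, insert a y ∈ X)
    (hY : ∀ z ∈ Y, ∀ a, z.erase a ∈ Y) (R : Finset α → Prop) [DecidablePred R] (i : ℕ) :
    #((X ×ˢ Y).filter fun p => Disjoint p.1 p.2 ∧ R (p.1 ∪ p.2) ∧ i ≤ #p.2) ≤
      #((X ×ˢ Y).filter fun p => Disjoint p.1 p.2 ∧ R (p.1 ∪ p.2) ∧ i ≤ #p.1) := by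
  set T : Finset (Finset α) := ((X ×ˢ Y).image fun p => p.1 ∪ p.2).filter R with hT
  have hmaps : ∀ (Q : ℕ → ℕ → Prop) [DecidableRel Q],
      (((X ×ˢ Y).filter fun p => Disjoint p.1 p.2 ∧ R (p.1 ∪ p.2) ∧ Q #p.1 #p.2 : Finset (Finset α × Finset α)) :
        Set (Finset α × Finset α)).MapsTo (fun p => p.1 ∪ p.2) T := by
    intro Q _ p hp
    rw [mem_coe, mem_filter] at hp
    change p.1 ∪ p.2 ∈ (T : Set (Finset α))
    rw [mem_coe, hT, mem_filter]
    exact ⟨mem_image_of_mem _ hp.1, hp.2.2.1⟩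
  have hsplit : ∀ (Q : ℕ → ℕ → Prop) [DecidableRel Q],
      #((X ×ˢ Y).filter fun p => Disjoint p.1 p.2 ∧ R (p.1 ∪ p.2) ∧ Q #p.1 #p.2) =
        ∑ W ∈ T, #((W.powerset.filter fun y => y ∈ X ∧ W \ y ∈ Y).filter fun y => Q #y (#W - #y)) := by
    intro Q _
    rw [card_eq_sum_card_fiberwise (hmaps Q)]
    refine sum_congr rfl fun W hW => ?_
    rw [hT, mem_filter] at hW
    rw [← card_pairs_fibre_eq X Y W Q]
    congr 1; ext p
    simp only [mem_filter]
    constructor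
    · rintro ⟨⟨hp, hd, -, hQ⟩, hWp⟩; exact ⟨hp, hd, hWp, hQ⟩
    · rintro ⟨hp, hd, hWp, hQ⟩; exact ⟨⟨hp, hd, hWp.symm ▸ hW.2, hQ⟩, hWp⟩
  rw [hsplit (fun a b => i ≤ b), hsplit (fun a b => i ≤ a)]
  refine sum_le_sum fun W _ => ?_
  set F : Finset (Finset α) := W.powerset.filter fun y => y ∈ X ∧ W \ y ∈ Y with hF
  have hFW : ∀ y ∈ F, y ⊆ W := fun y hy => mem_powerset.1 (mem_filter.1 hy).1
  have hup : ∀ y ∈ F, ∀ a ∈ W, insert a y ∈ F := by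
    intro y hy a ha
    rw [hF, mem_filter, mem_powerset] at hy ⊢
    obtain ⟨hyW, hyX, hyY⟩ := hy
    refine ⟨insert_subset ha hyW, hX y hyX a, ?_⟩
    rw [sdiff_insert]
    exact hY _ hyY a
  have hle : #(F.filter fun y => i ≤ #W - #y) = #(F.filter fun y => #y + i ≤ #W) := by
    congr 1
    refine filter_congr fun y hy => ?_
    have := card_le_card (hFW y hy)
    omega
  rw [hle]
  exact card_filter_add_le_le_card_filter_le W F hFW hup i

/-- Up-sets of finite sets are `insert`-closed. [folklore] -/
theorem insert_mem_of_isUpperSet {X : Finset (Finset α)} (hX : IsUpperSet (X : Set (Finset α))) {y : Finset α}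
    (hy : y ∈ X) (a : α) : insert a y ∈ X :=
  mem_coe.1 (hX (subset_insert a y) (mem_coe.2 hy))

/-- Down-sets of finite sets are `erase`-closed. [folklore] -/
theorem erase_mem_of_isLowerSet {Y : Finset (Finset α)} (hY : IsLowerSet (Y : Set (Finset α))) {z : Finset α}
    (hz : z ∈ Y) (a : α) : z.erase a ∈ Y :=
  mem_coe.1 (hY (erase_subset a z) (mem_coe.2 hz))

/-- **SIZE DOMINANCE, `IsUpperSet` / `IsLowerSet` form** for an up-set `X` and a down-set `Y` of
`Finset α`, among disjoint pairs `(y,z) ∈ X × Y` the ones with `i ≤ #z` are at most as many as the ones with `i ≤ #y`.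
[this work] -/
theorem card_filter_snd_le_card_filter_fst_of_isUpperSet (X Y : Finset (Finset α))
    (hX : IsUpperSet (X : Set (Finset α))) (hY : IsLowerSet (Y : Set (Finset α))) (i : ℕ) :
    #((X ×ˢ Y).filter fun p => Disjoint p.1 p.2 ∧ i ≤ #p.2) ≤
      #((X ×ˢ Y).filter fun p => Disjoint p.1 p.2 ∧ i ≤ #p.1) :=
  card_filter_snd_le_card_filter_fst X Y (fun _ hy a => insert_mem_of_isUpperSet hX hy a)
    (fun _ hz a => erase_mem_of_isLowerSet hY hz a) i

section Fintype

variable [Fintype α]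

/-- **Graded Kleitman** (`Y` = all sets): in disjoint pairs (member of an up-set `X`, arbitrary set) the member is
stochastically larger — `#{(y,z) : y ∈ X, y ∩ z = ∅, i ≤ #z} ≤ #{(y,z) : y ∈ X, y ∩ z = ∅, i ≤ #y}`. [this work] -/
theorem card_filter_snd_le_card_filter_fst_univ (X : Finset (Finset α)) (hX : IsUpperSet (X : Set (Finset α))) (i : ℕ) :
    #((X ×ˢ (univ : Finset (Finset α))).filter fun p => Disjoint p.1 p.2 ∧ i ≤ #p.2) ≤
      #((X ×ˢ (univ : Finset (Finset α))).filter fun p => Disjoint p.1 p.2 ∧ i ≤ #p.1) :=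
  card_filter_snd_le_card_filter_fst X univ (fun _ hy a => insert_mem_of_isUpperSet hX hy a)
    (fun _ _ _ => mem_univ _) i

/-- **Member versus non-member** (`Y = Xᶜ`): in disjoint (member, non-member) pairs of an up-set the member is
stochastically larger — `#{(y,z) : y ∈ X, z ∉ X, y ∩ z = ∅, i ≤ #z} ≤ #{… i ≤ #y}`. [this work] -/
theorem card_filter_snd_le_card_filter_fst_compl (X : Finset (Finset α)) (hX : IsUpperSet (X : Set (Finset α))) (i : ℕ) :
    #((X ×ˢ Xᶜ).filter fun p => Disjoint p.1 p.2 ∧ i ≤ #p.2) ≤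
      #((X ×ˢ Xᶜ).filter fun p => Disjoint p.1 p.2 ∧ i ≤ #p.1) := by
  refine card_filter_snd_le_card_filter_fst X Xᶜ (fun _ hy a => insert_mem_of_isUpperSet hX hy a)
    (fun z hz a => ?_) i
  rw [mem_compl] at hz ⊢
  exact fun h => hz (mem_coe.1 (hX (erase_subset a z) (mem_coe.2 h)))

omit [Fintype α] in
/-- Swapping the two coordinates of the pairs exchanges the roles of the size conditions. [folklore] -/
theorem card_filter_swap (X Y : Finset (Finset α)) (Q : ℕ → ℕ → Prop) [DecidableRel Q] :
    #((X ×ˢ Y).filter fun p => Disjoint p.1 p.2 ∧ Q #p.1 #p.2) =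
      #((Y ×ˢ X).filter fun p => Disjoint p.1 p.2 ∧ Q #p.2 #p.1) := by
  refine card_bij' (fun p _ => p.swap) (fun p _ => p.swap) (fun p hp => ?_) (fun p hp => ?_)
    (fun p _ => Prod.swap_swap p) (fun p _ => Prod.swap_swap p)
  · rw [mem_filter, mem_product] at hp ⊢
    exact ⟨⟨hp.1.2, hp.1.1⟩, hp.2.1.symm, hp.2.2⟩
  · rw [mem_filter, mem_product] at hp ⊢
    exact ⟨⟨hp.1.2, hp.1.1⟩, hp.2.1.symm, hp.2.2⟩

/-- **Shell versus core** (Corollary (♣) of the lane's memo, the face `{V¹ = W¹ = ⊤}` of the threshold recursion in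
counting form).  For an up-set `D` and ANY family `E` of `Finset α` (the memo's case: an up-set `E ⊇ D`) and every threshold `i`:
`#{(x,S) : x ∩ S = ∅, i ≤ #x, x ∈ E \ D, S ∈ D} ≤ #{(x,S) : x ∩ S = ∅, i ≤ #x, x ∉ E \ D, S ∉ D}`.
Proof: the left side grows and the right side shrinks with `E`, so `E = univ` is the worst case, where the statement is
`card_filter_snd_le_card_filter_fst_compl` after swapping the pair. [this work] -/
theorem card_shell_core_le (D E : Finset (Finset α)) (hD : IsUpperSet (D : Set (Finset α))) (i : ℕ) :
    #(((E \ D) ×ˢ D).filter fun p => Disjoint p.1 p.2 ∧ i ≤ #p.1) ≤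
      #(((E \ D)ᶜ ×ˢ Dᶜ).filter fun p => Disjoint p.1 p.2 ∧ i ≤ #p.1) := by
  have h1 : #(((E \ D) ×ˢ D).filter fun p => Disjoint p.1 p.2 ∧ i ≤ #p.1) ≤
      #((Dᶜ ×ˢ D).filter fun p => Disjoint p.1 p.2 ∧ i ≤ #p.1) := by
    refine card_le_card fun p hp => ?_
    rw [mem_filter, mem_product] at hp ⊢
    rw [mem_sdiff] at hp
    exact ⟨⟨mem_compl.2 hp.1.1.2, hp.1.2⟩, hp.2⟩
  have h2 : #((D ×ˢ Dᶜ).filter fun p => Disjoint p.1 p.2 ∧ i ≤ #p.1) ≤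
      #(((E \ D)ᶜ ×ˢ Dᶜ).filter fun p => Disjoint p.1 p.2 ∧ i ≤ #p.1) := by
    refine card_le_card fun p hp => ?_
    rw [mem_filter, mem_product] at hp ⊢
    refine ⟨⟨mem_compl.2 fun h => (mem_sdiff.1 h).2 hp.1.1, hp.1.2⟩, hp.2⟩
  have h3 : #((Dᶜ ×ˢ D).filter fun p => Disjoint p.1 p.2 ∧ i ≤ #p.1) =
      #((D ×ˢ Dᶜ).filter fun p => Disjoint p.1 p.2 ∧ i ≤ #p.2) :=
    card_filter_swap Dᶜ D (fun a _ => i ≤ a)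
  have h4 := card_filter_snd_le_card_filter_fst_compl D hD i
  omega

end Fintype

end Summit.CriticalPhenomena.PercolationContinuityZ3.Theorems.SizeDominance
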